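import Literature.Computability.Cryptography.VanDamSeroussiPhaseGrid
import Literature.Computability.Complexity.TrigTurnFP
import HarnessLib

/-!
# The classical decoder of the van Dam–Seroussi algorithm: rational scores on the grid

Topic `Literature/Computability/Cryptography`; support for the discharge of
`VanDamSeroussi2002_gaussSumPhase_qsolvable`, the sequel of `VanDamSeroussiPhaseGrid.lean` (from any
scores `σ_j ≈ Re(u · conj e(j/4t))` on the grid `j < 4t` a maximiser `ĵ` gives `m = ⌊(ĵ+2)/4⌋ mod t`
with `|arg(u · conj e(m/t))| ≤ 2π/t`). van Dam–Seroussi 2002 (§3.1 Fact 2, §4 Thm. 1) read the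
phase off the sampled statistics; the tree's post-processor must do so in EXACT RATIONAL arithmetic
(it is a polynomial-time string function): from the two empirical means `r_R ≈ Re z`, `r_I ≈ Im z`
of the interference copies and the KNOWN rotation `ρ = e(q_ω)` taking the copies' `z` to the target
`u = ρ z` (the reference Gauss sum and the twist `χ⁻¹(b)`), it computes

  `score_j = (ĉ r_R − ŝ r_I) · Ĉ_j + (ŝ r_R + ĉ r_I) · Ŝ_j`,

`ĉ, ŝ, Ĉ_j, Ŝ_j` the rational approximations `TrigTurn.cosTurn/sinTurn` of `cos, sin` of `2πq_ω` and
`2πj/4t` (Brent 1976 / the tree's `TrigTurnFP.lean`), then the first maximiser and the output.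

* `Decode.rotC`, `Decode.rotS`, `Decode.score`, `Decode.argmaxN` (`argmaxN_lt`, `le_argmaxN`),
  `Decode.output`;
* **`Decode.abs_score_sub_le`** — `|score_j − Re(ρ z · conj e(j/T))| ≤ 8ε + 28/2^kk` when
  `|r_R − Re z|, |r_I − Im z| ≤ ε ≤ 1`, `|z| = 1`;
* **`Decode.abs_arg_output_le`** — if `2(8ε + 28/2^kk) < cos(π/4t) − cos(2π/4t)` and `t ≥ 2` then
  `|arg(ρ z · conj e(output/t))| ≤ 2π/t`.

Everything is proved; the definitions have bodies; no named fact.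

## References

* W. van Dam, G. Seroussi, arXiv:quant-ph/0207131 (2002), §3.1 Fact 2, §4 Thm. 1 [VanDamSeroussi2002].
* R. P. Brent, *Fast multiple-precision evaluation of elementary functions*, J. ACM 23 (1976)
  (polynomial-time trigonometric approximation; the tree's `TrigTurn.cosTurn`) [Brent1976].
-/

noncomputable section

namespace Literature.Computability.Cryptography

namespace VanDamSeroussi

namespace Decode

open Complex Real
open Literature.Computability.QuantumComplexity.QFTQubits (eR eR_add norm_eR)
open Literature.Computability.Complexity.TrigTurn (cosTurn sinTurn abs_cos_sub_cosTurn_le abs_sin_sub_sinTurn_le)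

/-! ### The decoder -/

/-- The rotated cosine estimate `ĉ r_R − ŝ r_I ≈ Re(ρ z)`. [cite: VanDamSeroussi2002, §4 Thm. 1 (proof)] -/
def rotC (kk : ℕ) (qω rR rI : ℚ) : ℚ := cosTurn kk qω * rR - sinTurn kk qω * rI

/-- The rotated sine estimate `ŝ r_R + ĉ r_I ≈ Im(ρ z)`. [cite: VanDamSeroussi2002, §4 Thm. 1 (proof)] -/
def rotS (kk : ℕ) (qω rR rI : ℚ) : ℚ := sinTurn kk qω * rR + cosTurn kk qω * rI

/-- **The score of the grid angle `2πj/T`**: `≈ Re(ρ z · conj e(j/T)) = cos(γ − 2πj/T)`.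
[cite: VanDamSeroussi2002, §3.1 Fact 2] -/
def score (kk T : ℕ) (qω rR rI : ℚ) (j : ℕ) : ℚ :=
  rotC kk qω rR rI * cosTurn kk ((j : ℚ) / T) + rotS kk qω rR rI * sinTurn kk ((j : ℚ) / T)

/-- The first maximiser of `f` on `[0, n)` (`0` for `n = 0`). [folklore] -/
def argmaxN (f : ℕ → ℚ) : ℕ → ℕ
  | 0 => 0
  | n + 1 => if f (argmaxN f n) < f n then n else argmaxN f n

/-- The maximiser is below `n` (`n > 0`). [folklore] -/
theorem argmaxN_lt (f : ℕ → ℚ) : ∀ {n : ℕ}, 0 < n → argmaxN f n < n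
  | 0, h => absurd h (lt_irrefl 0)
  | n + 1, _ => by
    unfold argmaxN
    split_ifs
    · exact Nat.lt_succ_self n
    · rcases Nat.eq_zero_or_pos n with rfl | hn
      · exact Nat.zero_lt_one
      · exact (argmaxN_lt f hn).trans (Nat.lt_succ_self n)

/-- The maximiser maximises. [folklore] -/
theorem le_argmaxN (f : ℕ → ℚ) : ∀ (n j : ℕ), j < n → f j ≤ f (argmaxN f n)
  | 0, _, hj => absurd hj (Nat.not_lt_zero _)
  | n + 1, j, hj => by
    unfold argmaxN
    rcases Nat.lt_succ_iff_lt_or_eq.1 hj with hj' | rfl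
    · have ih := le_argmaxN f n j hj'
      split_ifs with h
      · exact ih.trans h.le
      · exact ih
    · split_ifs with h
      · exact le_rfl
      · exact not_lt.1 h

/-- **The output**: `m = ⌊(ĵ + 2)/4⌋ mod t` for the first maximiser `ĵ` of the scores on the grid
`j < 4t`. [cite: VanDamSeroussi2002, §4 Thm. 1] -/
def output (kk t : ℕ) (qω rR rI : ℚ) : ℕ := (argmaxN (score kk (4 * t) qω rR rI) (4 * t) + 2) / 4 % t

/-! ### The scores are close to the cosines -/

/-- `|xy − x'y'| ≤ |x| |y − y'| + |y'| |x − x'|`. [folklore] -/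
theorem abs_mul_sub_mul_le' (x y x' y' : ℝ) : |x * y - x' * y'| ≤ |x| * |y - y'| + |y'| * |x - x'| := by
  have : x * y - x' * y' = x * (y - y') + y' * (x - x') := by ring
  rw [this]
  exact (abs_add_le _ _).trans (by rw [abs_mul, abs_mul])

/-- Products of approximations: `|x| ≤ M`, `|y'| ≤ N`, `|x − x'| ≤ a`, `|y − y'| ≤ b` give
`|xy − x'y'| ≤ M b + N a`. [folklore] -/
theorem abs_mul_sub_mul_le_of {x y x' y' a b M N : ℝ} (hx : |x - x'| ≤ a) (hy : |y - y'| ≤ b)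
    (hM : |x| ≤ M) (hN : |y'| ≤ N) : |x * y - x' * y'| ≤ M * b + N * a := by
  refine (abs_mul_sub_mul_le' x y x' y').trans (add_le_add ?_ ?_)
  · exact mul_le_mul hM hy (abs_nonneg _) ((abs_nonneg _).trans hM)
  · exact mul_le_mul hN hx (abs_nonneg _) ((abs_nonneg _).trans hN)

/-- The components of `e(q)`. [folklore] -/
theorem eR_re_im (q : ℝ) : (eR q).re = Real.cos (2 * π * q) ∧ (eR q).im = Real.sin (2 * π * q) := by
  rw [eR_eq_exp_mul_I]
  exact ⟨Complex.exp_ofReal_mul_I_re _, Complex.exp_ofReal_mul_I_im _⟩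

/-- The target in coordinates: `Re(ρ z · conj w) = (cX − sY) Re w + (sX + cY) Im w` for `ρ = c + is`,
`z = X + iY`. [folklore] -/
theorem re_mul_mul_conj (ρ z w : ℂ) :
    (ρ * z * (starRingEnd ℂ) w).re = (ρ.re * z.re - ρ.im * z.im) * w.re + (ρ.im * z.re + ρ.re * z.im) * w.im := by
  simp only [Complex.mul_re, Complex.mul_im, Complex.conj_re, Complex.conj_im]
  ring

/-- **The scores are within `8ε + 28/2^kk` of the cosines** `Re(ρ z · conj e(j/T))`, `ρ = e(q_ω)`,
when the empirical means are within `ε ≤ 1` of `Re z`, `Im z` (`|z| = 1`, `0 ≤ q_ω ≤ 1`, `j ≤ T`, `T > 0`).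
[cite: VanDamSeroussi2002, §4 Thm. 1 (proof)] [cite: Brent1976, §1] -/
theorem abs_score_sub_le (kk : ℕ) {T : ℕ} (hT : 0 < T) {qω : ℚ} (hq0 : 0 ≤ qω) (hq1 : qω ≤ 1) {z : ℂ}
    (hz : ‖z‖ = 1) {rR rI : ℚ} {ε : ℝ} (hε1 : ε ≤ 1) (hR : |(rR : ℝ) - z.re| ≤ ε) (hI : |(rI : ℝ) - z.im| ≤ ε)
    {j : ℕ} (hj : j ≤ T) :
    |(score kk T qω rR rI j : ℝ) - (eR qω * z * (starRingEnd ℂ) (eR ((j : ℝ) / T))).re| ≤ 8 * ε + 28 / 2 ^ kk := by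
  have hε0 : 0 ≤ ε := (abs_nonneg _).trans hR
  set τ : ℝ := 1 / 2 ^ kk with hτ
  have hτ0 : 0 ≤ τ := by positivity
  have hτ1 : τ ≤ 1 := by
    rw [hτ, div_le_one (by positivity)]; exact one_le_pow₀ (by norm_num)
  -- the exact quantities
  obtain ⟨hρre, hρim⟩ := eR_re_im (qω : ℝ)
  have hjT0 : (0 : ℚ) ≤ (j : ℚ) / T := by positivity
  have hjT1 : (j : ℚ) / T ≤ 1 := by
    rw [div_le_one (by exact_mod_cast hT)]; exact_mod_cast hj
  obtain ⟨hwre, hwim⟩ := eR_re_im ((j : ℝ) / T)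
  set c := Real.cos (2 * π * qω) with hc
  set s := Real.sin (2 * π * qω) with hs
  set C := Real.cos (2 * π * ((j : ℝ) / T)) with hC
  set S := Real.sin (2 * π * ((j : ℝ) / T)) with hS
  set X := z.re with hX
  set Y := z.im with hY
  -- the approximations
  have hcc : |(cosTurn kk qω : ℝ) - c| ≤ τ := by rw [abs_sub_comm]; exact abs_cos_sub_cosTurn_le kk hq0 hq1
  have hss : |(sinTurn kk qω : ℝ) - s| ≤ τ := by rw [abs_sub_comm]; exact abs_sin_sub_sinTurn_le kk hq0 hq1
  have hCC : |(cosTurn kk ((j : ℚ) / T) : ℝ) - C| ≤ τ := by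
    rw [abs_sub_comm, hC, show ((j : ℝ) / T) = (((j : ℚ) / T : ℚ) : ℝ) by push_cast; rfl]
    exact abs_cos_sub_cosTurn_le kk hjT0 hjT1
  have hSS : |(sinTurn kk ((j : ℚ) / T) : ℝ) - S| ≤ τ := by
    rw [abs_sub_comm, hS, show ((j : ℝ) / T) = (((j : ℚ) / T : ℚ) : ℝ) by push_cast; rfl]
    exact abs_sin_sub_sinTurn_le kk hjT0 hjT1
  -- sizes
  have hXle : |X| ≤ 1 := (abs_re_le_norm z).trans hz.le
  have hYle : |Y| ≤ 1 := (abs_im_le_norm z).trans hz.le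
  have hcle : |c| ≤ 1 := Real.abs_cos_le_one _
  have hsle : |s| ≤ 1 := Real.abs_sin_le_one _
  have hCle : |C| ≤ 1 := Real.abs_cos_le_one _
  have hSle : |S| ≤ 1 := Real.abs_sin_le_one _
  have hrRle : |(rR : ℝ)| ≤ 2 := by
    have := abs_sub_abs_le_abs_sub (rR : ℝ) X; linarith
  have hrIle : |(rI : ℝ)| ≤ 2 := by
    have := abs_sub_abs_le_abs_sub (rI : ℝ) Y; linarith
  have hchle : |(cosTurn kk qω : ℝ)| ≤ 2 := by
    have := abs_sub_abs_le_abs_sub (cosTurn kk qω : ℝ) c; linarith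
  have hshle : |(sinTurn kk qω : ℝ)| ≤ 2 := by
    have := abs_sub_abs_le_abs_sub (sinTurn kk qω : ℝ) s; linarith
  -- products of estimates: `|ĉ r̂ − c X| ≤ 2ε + 1τ ≤ 2ε + 2τ`
  have hp1 : |(cosTurn kk qω : ℝ) * rR - c * X| ≤ 2 * ε + 2 * τ :=
    (abs_mul_sub_mul_le_of hcc hR hchle hXle).trans (by linarith)
  have hp2 : |(sinTurn kk qω : ℝ) * rI - s * Y| ≤ 2 * ε + 2 * τ :=
    (abs_mul_sub_mul_le_of hss hI hshle hYle).trans (by linarith)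
  have hp3 : |(sinTurn kk qω : ℝ) * rR - s * X| ≤ 2 * ε + 2 * τ :=
    (abs_mul_sub_mul_le_of hss hR hshle hXle).trans (by linarith)
  have hp4 : |(cosTurn kk qω : ℝ) * rI - c * Y| ≤ 2 * ε + 2 * τ :=
    (abs_mul_sub_mul_le_of hcc hI hchle hYle).trans (by linarith)
  -- the rotated estimates
  have hrotC : |(rotC kk qω rR rI : ℝ) - (c * X - s * Y)| ≤ 4 * ε + 4 * τ := by
    have e : (rotC kk qω rR rI : ℝ) - (c * X - s * Y) =
        ((cosTurn kk qω : ℝ) * rR - c * X) - ((sinTurn kk qω : ℝ) * rI - s * Y) := by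
      simp only [rotC]; push_cast; ring
    rw [e]
    exact (abs_sub _ _).trans (by linarith)
  have hrotS : |(rotS kk qω rR rI : ℝ) - (s * X + c * Y)| ≤ 4 * ε + 4 * τ := by
    have e : (rotS kk qω rR rI : ℝ) - (s * X + c * Y) =
        ((sinTurn kk qω : ℝ) * rR - s * X) + ((cosTurn kk qω : ℝ) * rI - c * Y) := by
      simp only [rotS]; push_cast; ring
    rw [e]
    exact (abs_add_le _ _).trans (by linarith)
  have hmul1 : ∀ {u v : ℝ}, |u| ≤ 1 → |v| ≤ 1 → |u * v| ≤ 1 := fun hu hv => by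
    rw [abs_mul]; exact mul_le_one₀ hu (abs_nonneg _) hv
  have htrueC : |c * X - s * Y| ≤ 2 :=
    (abs_sub _ _).trans (by have := hmul1 hcle hXle; have := hmul1 hsle hYle; linarith)
  have htrueS : |s * X + c * Y| ≤ 2 :=
    (abs_add_le _ _).trans (by have := hmul1 hsle hXle; have := hmul1 hcle hYle; linarith)
  have hrotCle : |(rotC kk qω rR rI : ℝ)| ≤ 10 := by
    have := abs_sub_abs_le_abs_sub (rotC kk qω rR rI : ℝ) (c * X - s * Y); linarith
  have hrotSle : |(rotS kk qω rR rI : ℝ)| ≤ 10 := by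
    have := abs_sub_abs_le_abs_sub (rotS kk qω rR rI : ℝ) (s * X + c * Y); linarith
  -- the two terms of the score: `10 τ + 1 (4ε + 4τ) ≤ 4ε + 14τ`; recorded as `2ε + 12τ` doubled below
  have ht1 : |(rotC kk qω rR rI : ℝ) * (cosTurn kk ((j : ℚ) / T) : ℝ) - (c * X - s * Y) * C| ≤ 4 * ε + 14 * τ :=
    (abs_mul_sub_mul_le_of hrotC hCC hrotCle hCle).trans (by linarith)
  have ht2 : |(rotS kk qω rR rI : ℝ) * (sinTurn kk ((j : ℚ) / T) : ℝ) - (s * X + c * Y) * S| ≤ 4 * ε + 14 * τ :=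
    (abs_mul_sub_mul_le_of hrotS hSS hrotSle hSle).trans (by linarith)
  -- assemble
  have htarget : (eR qω * z * (starRingEnd ℂ) (eR ((j : ℝ) / T))).re = (c * X - s * Y) * C + (s * X + c * Y) * S := by
    rw [re_mul_mul_conj, hρre, hρim, hwre, hwim]
  have hscore : (score kk T qω rR rI j : ℝ) =
      (rotC kk qω rR rI : ℝ) * (cosTurn kk ((j : ℚ) / T) : ℝ) + (rotS kk qω rR rI : ℝ) * (sinTurn kk ((j : ℚ) / T) : ℝ) := by
    simp only [score]; push_cast; ring
  rw [htarget, hscore]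
  have e : (rotC kk qω rR rI : ℝ) * (cosTurn kk ((j : ℚ) / T) : ℝ) + (rotS kk qω rR rI : ℝ) * (sinTurn kk ((j : ℚ) / T) : ℝ) -
      ((c * X - s * Y) * C + (s * X + c * Y) * S) =
      ((rotC kk qω rR rI : ℝ) * (cosTurn kk ((j : ℚ) / T) : ℝ) - (c * X - s * Y) * C) +
        ((rotS kk qω rR rI : ℝ) * (sinTurn kk ((j : ℚ) / T) : ℝ) - (s * X + c * Y) * S) := by ring
  rw [e]
  refine (abs_add_le _ _).trans ?_
  have : 8 * ε + 28 / 2 ^ kk = (4 * ε + 14 * τ) + (4 * ε + 14 * τ) := by rw [hτ]; ring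
  rw [this]
  exact add_le_add ht1 ht2

/-! ### The output is a valid answer -/

/-- **The decoder's output is within `2π/t` of the phase**: for `t ≥ 2`, `|z| = 1`, `0 ≤ q_ω ≤ 1`,
empirical means within `ε ≤ 1` of `Re z, Im z`, and `2(8ε + 28/2^kk) < cos(π/4t) − cos(2π/4t)`,
`|arg(e(q_ω) z · conj e(m/t))| ≤ 2π/t` for `m = output`. [cite: VanDamSeroussi2002, §3.1 Fact 2 and §4 Thm. 1] -/
theorem abs_arg_output_le {t : ℕ} (ht : 2 ≤ t) (kk : ℕ) {qω : ℚ} (hq0 : 0 ≤ qω) (hq1 : qω ≤ 1) {z : ℂ}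
    (hz : ‖z‖ = 1) {rR rI : ℚ} {ε : ℝ} (hε1 : ε ≤ 1) (hR : |(rR : ℝ) - z.re| ≤ ε) (hI : |(rI : ℝ) - z.im| ≤ ε)
    (hgap : 2 * (8 * ε + 28 / 2 ^ kk) < Real.cos (π / (4 * t : ℕ)) - Real.cos (2 * π / (4 * t : ℕ))) :
    |arg (eR qω * z * (starRingEnd ℂ) (eR (((output kk t qω rR rI : ℕ) : ℝ) / t)))| ≤ 2 * π / t := by
  have h4t : 0 < 4 * t := by omega
  have hu : ‖eR qω * z‖ = 1 := by rw [norm_mul, norm_eR, hz, one_mul]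
  set σ : ℕ → ℝ := fun j => (score kk (4 * t) qω rR rI j : ℝ) with hσ
  have hσ' : ∀ j, j < 4 * t → |σ j - 1 * (eR qω * z * (starRingEnd ℂ) (eR ((j : ℝ) / (4 * t : ℕ)))).re| ≤ 8 * ε + 28 / 2 ^ kk := by
    intro j hj
    rw [one_mul, show ((4 * t : ℕ) : ℝ) = ((4 * t : ℕ) : ℝ) from rfl]
    have := abs_score_sub_le kk h4t hq0 hq1 hz hε1 hR hI hj.le
    simpa only [hσ, Nat.cast_mul, Nat.cast_ofNat] using this
  have hjm := argmaxN_lt (score kk (4 * t) qω rR rI) h4t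
  have hmax : ∀ j, j < 4 * t → σ j ≤ σ (argmaxN (score kk (4 * t) qω rR rI) (4 * t)) := fun j hj => by
    simp only [hσ]; exact_mod_cast le_argmaxN _ _ _ hj
  have key := abs_arg_grid_output_le hu ht one_pos σ hσ' (by rw [one_mul]; exact hgap) hjm hmax
  exact key

end Decode

end VanDamSeroussi

end Literature.Computability.Cryptography

end
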